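import Literature.AlgebraicGeometry.Morphisms.CofanOfClosedCover
import Literature.AlgebraicGeometry.Motives.ClosedSubschemeTowerLift
import HarnessLib

/-!
# A reduced closed subscheme whose underlying set is a finite disjoint union of closed subschemes of the ambient scheme is
# their coproduct

Topic `Literature/AlgebraicGeometry/Morphisms`, namespace `Literature.AlgebraicGeometry.Morphisms`. PROOF FILE (theorems only;
no definition, no named fact, no instance, no `sorry`).

For `B`-schemes: let `j : Y ⟶ W` be a closed immersion with `Y` REDUCED, and `(κ_i : Z_i ⟶ W)_{i ∈ σ}` a FINITE family of closed
immersions from reduced `Z_i` whose images are pairwise disjoint with union EXACTLY the image of `j`.  Then the `κ_i` lift uniquely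
to `ι_i : Z_i ⟶ Y` (`ι_i ≫ j = κ_i`; ★ `Motives.existsUnique_overHom_comp_eq_of_range_subset`, [GortzWedhorn2020] Prop. 4.32), the
lifts are closed immersions with pairwise disjoint images covering `Y`, and therefore (★ `nonempty_isColimit_cofan_over_of_isClosedImmersion`)
`Y ≅ ∐_i Z_i`: the cofan `(ι_i)` is a COLIMIT in `Over B` (`exists_lift_isColimit_cofan_of_closed_cover`).

Consumer (cell hodgecm-mathlib, road (ii) L3.6 F-COFAN): `W = (M_K)_τ` a level of the unitary Shimura SURFACE's canonical model over
`ℂ`, `Y = (M⋆_{K⋆})_τ` the descended curve (★ `RecordSystem.exists_descendedTower`: reduced, image = the closure of the embedded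
curve), `Z_{q,i}` the special curves of the surface pieces (★ `exists_specialCurveSubscheme`): at an injective level they are pairwise
disjoint and exhaust the image, so `(M⋆_{K⋆})_τ ≅ ∐ Z_{q,i}` — the `pieces` clause of the curve's record.

## References
* [GortzWedhorn2020] U. Görtz, T. Wedhorn, *Algebraic Geometry I* (2nd ed. 2020), Prop. 4.32; §(3.5) Prop. 3.10, Example 3.11.
* [StacksProject] The Stacks project, Tag 0356, Tag 0F2M.
-/

set_option autoImplicit false

noncomputable section

open CategoryTheory CategoryTheory.Limits AlgebraicGeometry Set Function

namespace Literature.AlgebraicGeometry.Morphisms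

open _root_.Topology
open Literature.AlgebraicGeometry.Motives (existsUnique_overHom_comp_eq_of_range_subset)

universe u

/-- **Lifting a disjoint closed cover of the image through a reduced closed subscheme gives its coproduct decomposition.**  For a closed
immersion `j : Y ⟶ W` of `B`-schemes with `Y` reduced and finitely many closed immersions `κ_i : Z_i ⟶ W` (`Z_i` reduced) with pairwise
disjoint images whose union is the image of `j`: there are `ι_i : Z_i ⟶ Y` with `ι_i ≫ j = κ_i`, each a closed immersion, and the cofan
`(ι_i)` is a colimit in `Over B` (`Y ≅ ∐_i Z_i`). [cite: GortzWedhorn2020, Prop. 4.32 and §(3.5) Prop. 3.10] [cite: StacksProject, Tag 0356] -/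
theorem exists_lift_isColimit_cofan_of_closed_cover {σ : Type u} [Finite σ] {B : Scheme.{u}} {Y W : Over B} (j : Y ⟶ W)
    [IsClosedImmersion j.left] [IsReduced Y.left] {Z : σ → Over B} (κ : ∀ i, Z i ⟶ W)
    [∀ i, IsClosedImmersion (κ i).left] [∀ i, IsReduced (Z i).left]
    (hdisj : Pairwise (Disjoint on fun i => Set.range ⇑(κ i).left))
    (hcov : ⋃ i, Set.range ⇑(κ i).left = Set.range ⇑j.left) :
    ∃ ι : ∀ i, Z i ⟶ Y, (∀ i, ι i ≫ j = κ i) ∧ (∀ i, IsClosedImmersion (ι i).left) ∧ Nonempty (IsColimit (Cofan.mk Y ι)) := by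
  -- the lifts
  have hsub : ∀ i, Set.range ⇑(κ i).left ⊆ Set.range ⇑j.left := fun i => by
    rw [← hcov]; exact subset_iUnion (fun i => Set.range ⇑(κ i).left) i
  have hlift : ∀ i, ∃ m : Z i ⟶ Y, m ≫ j = κ i := fun i =>
    (existsUnique_overHom_comp_eq_of_range_subset j (κ i) (hsub i)).exists
  choose ι hι using hlift
  -- closed immersions
  have hcl : ∀ i, IsClosedImmersion (ι i).left := fun i => by
    haveI : IsClosedImmersion ((ι i).left ≫ j.left) := by
      rw [← Over.comp_left, hι i]; infer_instance
    exact IsClosedImmersion.of_comp_isClosedImmersion (ι i).left j.left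
  haveI := hcl
  -- images under `j`
  have hjι : ∀ i (z : (Z i).left), j.left ((ι i).left z) = (κ i).left z := fun i z => by
    change ((ι i).left ≫ j.left) z = _
    rw [← Over.comp_left, hι i]
  have hinj : Function.Injective ⇑j.left := j.left.isClosedEmbedding.injective
  -- pairwise disjoint images
  have hdisj' : Pairwise (Disjoint on fun i => Set.range ⇑(ι i).left) := by
    intro i i' hii'
    refine Set.disjoint_left.2 ?_
    rintro y ⟨z, rfl⟩ ⟨z', hz'⟩
    have h1 : j.left ((ι i).left z) ∈ Set.range ⇑(κ i).left := ⟨z, (hjι i z).symm⟩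
    have h2 : j.left ((ι i).left z) ∈ Set.range ⇑(κ i').left := ⟨z', by rw [← hjι i' z', hz']⟩
    exact Set.disjoint_left.1 (hdisj hii') h1 h2
  -- covering
  have hcov' : ⋃ i, Set.range ⇑(ι i).left = Set.univ := by
    rw [Set.eq_univ_iff_forall]
    intro y
    have hy : j.left y ∈ ⋃ i, Set.range ⇑(κ i).left := by rw [hcov]; exact ⟨y, rfl⟩
    obtain ⟨i, z, hz⟩ := Set.mem_iUnion.1 hy
    exact Set.mem_iUnion.2 ⟨i, z, hinj (by rw [hjι i z, hz])⟩
  exact ⟨ι, hι, hcl, nonempty_isColimit_cofan_over_of_isClosedImmersion ι hdisj' hcov'⟩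

end Literature.AlgebraicGeometry.Morphisms

end
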